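import Literature.Computability.Cryptography.RegevStagePost
import Literature.Computability.Cryptography.PeikertPerturbationGaussian
import HarnessLib

/-!
# Regev 2009, Theorem 3.1 in machine form, VII: the clamping tail of the discrete Gaussian

Topic `Computability/Cryptography` (family `pqc`), a small companion of `RegevStageOneCopy.lean`: the
one-sample stage machine clamps every vector it writes to code length `≤ L(|x|)` (so that a batch of
`N` of them fits in the window handed to the next stage), and its analysis charges the probability that
an ideal sample `v ∼ D_{L(B),ρ}` does NOT fit. This file bounds that probability: a vector of `L(B)` of
norm `< ρ√n ≤ 2ᵇ` has integer coordinates below `2ᵇ` in absolute value, hence a code of length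
`≤ codeLenBound n b` (`length_vecCode_le`, Arora–Barak 2009, §0.1: codes of tuples), and
`Pr_{v ∼ D_{L(B),ρ}}[‖v‖ ≥ ρ√n] ≤ 2⁻ⁿ` (Banaszczyk 1993, Lemma 1.5(i); Regev 2009, Lemma 2.5; the tree
theorem `toOuterMeasure_discreteGaussian_norm_ge_le`), so

  `Pr_{v ∼ D_{L(B),ρ}}[codeLenBound n b < |code v|] ≤ 2⁻ⁿ`      (`tail_codeLength_le`).

Everything is proved; no named fact.

## References

* O. Regev, *On lattices, learning with errors, random linear codes, and cryptography*, J. ACM 56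
  (2009), art. 34; author's version arXiv:2401.03703, Lemma 2.5 (Banaszczyk's tail bound) and §2
  p. 11 ("a model that approximates real numbers") [Regev2009].
* W. Banaszczyk, *New bounds in some transference theorems in the geometry of numbers*, Math. Ann.
  296 (1993) 625–635, Lemma 1.5(i) [Banaszczyk1993].
* S. Arora, B. Barak, *Computational Complexity: A Modern Approach*, CUP 2009, §0.1 [AroraBarak2009].
-/

noncomputable section

namespace Literature.Computability.Cryptography

namespace Regev2009

open _root_.Computability Literature.Computability.Complexity Literature.Algebra.EuclideanLattices
open scoped ENNReal

/-! ### Code lengths -/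

/-- `|code z| ≤ b + 4` for `|z| < 2ᵇ` (sign bit doubled, separator, `≤ b` binary digits).
[cite: AroraBarak2009, §0.1] -/
theorem length_encodeInt_le_of_lt {z : ℤ} {b : ℕ} (h : z.natAbs < 2 ^ b) : (encodingIntBool.encode z).length ≤ b + 4 := by
  show (boolPair [decide (z < 0)] (encodeNat z.natAbs)).length ≤ b + 4
  rw [length_boolPair, TM2Pass.length_encodeNat_eq_size, List.length_singleton]
  have := Nat.size_le.2 h
  omega

/-- The length of the body of a list code with items of length `≤ c`. [folklore] -/
theorem length_foldr_boolPair_le (e : ℤ → List Bool) {c : ℕ} : ∀ (l : List ℤ), (∀ a ∈ l, (e a).length ≤ c) →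
    (l.foldr (fun a acc => boolPair (e a) acc) []).length ≤ l.length * (2 * c + 2)
  | [], _ => by simp
  | a :: l, h => by
    rw [List.foldr_cons, length_boolPair, List.length_cons, Nat.add_mul, one_mul]
    have ha := h a (by simp)
    have hl := length_foldr_boolPair_le e l fun a' ha' => h a' (by simp [ha'])
    omega

/-- `|code v| ≤ 2n + 2 + n (2 (b + 4) + 2)` for an integer vector `v ∈ ℤⁿ` with entries below `2ᵇ`.
[cite: AroraBarak2009, §0.1 (codes of tuples)] -/
theorem length_finVec_encode_le {n : ℕ} (v : Fin n → ℤ) {b : ℕ} (h : ∀ i, (v i).natAbs < 2 ^ b) :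
    ((encodingIntVecFin n).encode v).length ≤ 2 * n + 2 + n * (2 * (b + 4) + 2) := by
  show (boolPair (unaryEncodeNat (List.ofFn v).length)
    ((List.ofFn v).foldr (fun a acc => boolPair (encodingIntBool.encode a) acc) [])).length ≤ _
  rw [length_boolPair]
  have hu : ∀ k : ℕ, (unaryEncodeNat k).length = k := fun k => by
    induction k with
    | zero => rfl
    | succ k ih => simp [unaryEncodeNat, ih]
  have hbody := length_foldr_boolPair_le encodingIntBool.encode (c := b + 4) (List.ofFn v) fun a ha => by
    obtain ⟨i, rfl⟩ := (List.mem_ofFn' _ _).1 ha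
    exact length_encodeInt_le_of_lt (h i)
  rw [List.length_ofFn] at hbody
  rw [hu, List.length_ofFn]
  omega

/-- **The code-length bound** for vectors of `ℤⁿ` with entries below `2ᵇ` in absolute value.
[cite: AroraBarak2009, §0.1] -/
def codeLenBound (n b : ℕ) : ℕ := 2 * (n + 1) + 2 + (2 * n + 2 + n * (2 * (b + 4) + 2))

/-- **`|vecCode n v| ≤ codeLenBound n b`** when all entries of `v` are below `2ᵇ` in absolute value.
[cite: AroraBarak2009, §0.1] -/
theorem length_vecCode_le {n : ℕ} (v : Fin n → ℤ) {b : ℕ} (h : ∀ i, (v i).natAbs < 2 ^ b) :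
    (vecCode n v).length ≤ codeLenBound n b := by
  rw [vecCode, encodeIntVec_eq, ← boolPair_encodeNat, length_boolPair, codeLenBound]
  have h1 := TM2Pass.length_encodeNat_le_self n
  have h2 := length_finVec_encode_le v h
  omega

/-! ### Entries and norm -/

/-- An entry of an integer vector is at most its Euclidean norm. [folklore] -/
theorem abs_cast_le_norm_intVecToEuclidean {n : ℕ} (v : Fin n → ℤ) (i : Fin n) :
    |((v i : ℤ) : ℝ)| ≤ ‖intVecToEuclidean n v‖ := by
  have h := EuclideanSpace.norm_eq (intVecToEuclidean n v)
  rw [h]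
  have hi : ((v i : ℝ)) ^ 2 ≤ ∑ j, ‖intVecToEuclidean n v j‖ ^ 2 := by
    have : ‖intVecToEuclidean n v i‖ ^ 2 = ((v i : ℝ)) ^ 2 := by
      rw [intVecToEuclidean_apply, Real.norm_eq_abs, sq_abs]
    rw [← this]
    exact Finset.single_le_sum (f := fun j => ‖intVecToEuclidean n v j‖ ^ 2) (fun j _ => by positivity) (Finset.mem_univ i)
  calc |((v i : ℤ) : ℝ)| = Real.sqrt (((v i : ℝ)) ^ 2) := (Real.sqrt_sq_eq_abs _).symm
    _ ≤ Real.sqrt (∑ j, ‖intVecToEuclidean n v j‖ ^ 2) := Real.sqrt_le_sqrt hi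

/-- **Short vectors have small entries**: `‖v‖ < 2ᵇ` implies `|vᵢ| < 2ᵇ`. [folklore] -/
theorem natAbs_lt_two_pow_of_norm_lt {n : ℕ} {v : Fin n → ℤ} {b : ℕ} (h : ‖intVecToEuclidean n v‖ < (2 : ℝ) ^ b)
    (i : Fin n) : (v i).natAbs < 2 ^ b := by
  have h1 := (abs_cast_le_norm_intVecToEuclidean v i).trans_lt h
  rw [← Int.cast_abs] at h1
  have h2 : |v i| < (2 : ℤ) ^ b := by exact_mod_cast h1
  have h3 : ((v i).natAbs : ℤ) < (2 : ℤ) ^ b := by rwa [Int.natCast_natAbs]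
  exact_mod_cast h3

/-! ### The clamping tail -/

/-- The dimension of `ℝⁿ`. [folklore] -/
theorem finrank_euclideanSpace_fin' (n : ℕ) : Module.finrank ℝ (EuclideanSpace ℝ (Fin n)) = n := by
  simp

/-- **The clamping tail of the discrete Gaussian**: for a nonsingular integer lattice `L(B) ⊆ ℤⁿ`,
`0 < ρ` and `ρ√n ≤ 2ᵇ`, `Pr_{v ∼ D_{L(B),ρ}}[codeLenBound n b < |code v|] ≤ 2⁻ⁿ` — such a vector has
norm `≥ 2ᵇ ≥ ρ√n`, an event of probability `≤ 2⁻ⁿ` (Banaszczyk's tail bound).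
[cite: Regev2009, Lemma 2.5; Banaszczyk1993, Lemma 1.5(i)] -/
theorem tail_codeLength_le (I : LatticeInstance) (hI : I.IsNonsingular) {ρ : ℝ} (hρ : 0 < ρ) {b : ℕ}
    (hb : ρ * Real.sqrt I.n ≤ (2 : ℝ) ^ b) :
    ((discreteGaussian I.lattice ρ 0).map I.intCoords).toOuterMeasure {v | codeLenBound I.n b < (vecCode I.n v).length} ≤
      (2⁻¹ : ℝ≥0∞) ^ I.n := by
  haveI := I.isZLattice_of_isNonsingular hI
  rw [PMF.toOuterMeasure_map_apply]
  have hsub : I.intCoords ⁻¹' {v | codeLenBound I.n b < (vecCode I.n v).length} ⊆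
      {x : I.lattice | ρ * Real.sqrt (Module.finrank ℝ (EuclideanSpace ℝ (Fin I.n))) ≤ ‖(x : EuclideanSpace ℝ (Fin I.n))‖} := by
    intro x hx
    by_contra hlt
    rw [Set.mem_setOf_eq, finrank_euclideanSpace_fin'] at hlt
    have hnorm : ‖intVecToEuclidean I.n (I.intCoords x)‖ < (2 : ℝ) ^ b := by
      rw [LatticeInstance.intVecToEuclidean_intCoords]
      exact (not_le.1 hlt).trans_le hb
    have hlen := length_vecCode_le (I.intCoords x) (natAbs_lt_two_pow_of_norm_lt hnorm)
    exact absurd hx (not_lt.2 hlen)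
  have h := Peikert2009.toOuterMeasure_discreteGaussian_norm_ge_le I.lattice hρ
  rw [finrank_euclideanSpace_fin'] at h hsub
  exact ((discreteGaussian I.lattice ρ 0).toOuterMeasure.mono hsub).trans h

/-- The same bound in real form: `≤ 2⁻ⁿ`. [cite: Regev2009, Lemma 2.5] -/
theorem toReal_tail_codeLength_le (I : LatticeInstance) (hI : I.IsNonsingular) {ρ : ℝ} (hρ : 0 < ρ) {b : ℕ}
    (hb : ρ * Real.sqrt I.n ≤ (2 : ℝ) ^ b) :
    (((discreteGaussian I.lattice ρ 0).map I.intCoords).toOuterMeasure {v | codeLenBound I.n b < (vecCode I.n v).length}).toReal ≤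
      (2⁻¹ : ℝ) ^ I.n := by
  have h := tail_codeLength_le I hI hρ hb
  have hne : (2⁻¹ : ℝ≥0∞) ^ I.n ≠ ⊤ := ENNReal.pow_ne_top (ENNReal.inv_ne_top.2 two_ne_zero)
  calc _ ≤ ((2⁻¹ : ℝ≥0∞) ^ I.n).toReal := ENNReal.toReal_mono hne h
    _ = (2⁻¹ : ℝ) ^ I.n := by rw [ENNReal.toReal_pow, ENNReal.toReal_inv, ENNReal.toReal_ofNat]

end Regev2009

end Literature.Computability.Cryptography

end
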